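import Literature.Geometry.Lorentzian.Basic
import HarnessLib

/-!
# Crux `GapExhaustion` (stmt-FinalStateConjecture-10808), line `photon-shell-pseudoconvexity`:
# stub (K-A3) `stub_curvatureLikeAlgebra` — the algebra of the Killing prolongation identity

Route `BartnikGapSettling`; helper (`--supports stmt-FinalStateConjecture-10808`) landing the
registered sub-stub (K-A3) of wave 2 of line lead c8 (LOCAL unique continuation of coordinate
Killing vector fields from a `1`-jet, the patching tool of the Ionescu–Klainerman sweeps): the
purely algebraic step of the classical prolongation `(∇_X ∇K)(Y) = R(X, K)Y` of a Killing field
`K` (O'Neill, Semi-Riemannian Geometry (1983), Ch. 9, Lemma 9.28; Kobayashi–Nomizu I, VI.2).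

Let `Rm X Y Z W` (`= g(R(X,Y)Z, W)`) have the symmetries of a curvature tensor — skew in the
first pair, skew in the last pair, first Bianchi identity, pair symmetry — and let `B X Y Z`
(`= g((∇_X ∇K) Y, Z)`) be skew in `(Y, Z)` with antisymmetrisation in `(X, Y)` equal to the Ricci
identity `Rm X Y k Z` (`k = K x`). Then `B X Y Z = Rm X k Y Z`.

Proof (term-chasing, no geometry): alternating the two hypotheses on `B` around the cycle
`(X,Y,Z) → (Y,Z,X) → (Z,X,Y)` gives `2 B X Y Z = Rm X Y k Z - Rm Y Z k X + Rm Z X k Y`, and the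
curvature symmetries (pair symmetry, one Bianchi identity, the two skew-symmetries) turn the
right-hand side into `2 Rm X k Y Z`; `linarith`.
-/

noncomputable section

-- D-0017: single-problem summit, `Summit.<S>.<S>.…` by design (cf. lakefile `weak.linter.dupNamespace`).
set_option linter.dupNamespace false

namespace Summit.FinalStateConjecture.FinalStateConjecture.Theorems

open Set Filter
open Literature.Geometry.Lorentzian

/-- **Stub (K-A3) of the local unique continuation of Killing fields (line
`photon-shell-pseudoconvexity`, crux `GapExhaustion`, stmt-FinalStateConjecture-10808) — the
algebra of the Killing prolongation identity.** Let `Rm : E4 → E4 → E4 → E4 → ℝ` be skew in its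
first two and in its last two arguments, satisfy the first Bianchi identity
`Rm X Y Z W + Rm Y Z X W + Rm Z X Y W = 0` and the pair symmetry `Rm X Y Z W = Rm Z W X Y`, and let
`B : E4 → E4 → E4 → ℝ` be skew in its last two arguments with `B X Y Z - B Y X Z = Rm X Y k Z`.
Then `B X Y Z = Rm X k Y Z` for all `X Y Z` (O'Neill 1983, Ch. 9, Lemma 9.28: for a Killing field
`K`, `g((∇_X ∇K) Y, Z) = g(R(X, K) Y, Z)`). Pure algebra: `linarith` from six instances of the
hypotheses on `B` and four instances of the curvature symmetries. [folklore] -/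
theorem stub_curvatureLikeAlgebra :
    ∀ (Rm : E4 → E4 → E4 → E4 → ℝ) (B : E4 → E4 → E4 → ℝ) (k : E4),
      (∀ X Y Z W : E4, Rm Y X Z W = -Rm X Y Z W) →
      (∀ X Y Z W : E4, Rm X Y W Z = -Rm X Y Z W) →
      (∀ X Y Z W : E4, Rm X Y Z W + Rm Y Z X W + Rm Z X Y W = 0) →
      (∀ X Y Z W : E4, Rm X Y Z W = Rm Z W X Y) →
      (∀ X Y Z : E4, B X Z Y = -B X Y Z) →
      (∀ X Y Z : E4, B X Y Z - B Y X Z = Rm X Y k Z) →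
      ∀ X Y Z : E4, B X Y Z = Rm X k Y Z := by
  intro Rm B k hskew12 hskew34 hcyc hpair hskew hRic X Y Z
  -- six instances of the two hypotheses on `B` around the cycle `(X,Y,Z) → (Y,Z,X) → (Z,X,Y)`:
  -- they sum to `2 B X Y Z = Rm X Y k Z - Rm Y Z k X + Rm Z X k Y`
  have h1 : B X Y Z - B Y X Z = Rm X Y k Z := hRic X Y Z
  have h2 : B Y X Z = -B Y Z X := hskew Y Z X
  have h3 : B Y Z X - B Z Y X = Rm Y Z k X := hRic Y Z X
  have h4 : B Z Y X = -B Z X Y := hskew Z X Y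
  have h5 : B Z X Y - B X Z Y = Rm Z X k Y := hRic Z X Y
  have h6 : B X Z Y = -B X Y Z := hskew X Y Z
  -- curvature symmetries: `Rm X Y k Z + Rm Z X k Y = Rm X k Y Z` (pair symmetry, Bianchi at
  -- `(k, Z, X; Y)`, skewness in the last pair) and `-Rm Y Z k X = Rm X k Y Z` (pair symmetry,
  -- skewness in the first pair)
  have hp1 : Rm X Y k Z = Rm k Z X Y := hpair X Y k Z
  have hb : Rm k Z X Y + Rm Z X k Y + Rm X k Z Y = 0 := hcyc k Z X Y
  have hs1 : Rm X k Z Y = -Rm X k Y Z := hskew34 X k Y Z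
  have hp2 : Rm Y Z k X = Rm k X Y Z := hpair Y Z k X
  have hs2 : Rm k X Y Z = -Rm X k Y Z := hskew12 X k Y Z
  linarith

end Summit.FinalStateConjecture.FinalStateConjecture.Theorems

end
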